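import Literature.Analysis.Calculus.PoincareLemmaHolomorphicOneForm
import Literature.AlgebraicGeometry.ShimuraVarieties.UnitaryBallAutomorphicForms
import HarnessLib

/-!
# Holomorphic primitives of closed holomorphic `(1,0)`-forms on the ball, and their periods

Layer `Literature/AlgebraicGeometry/ShimuraVarieties`, sequel of `UnitaryBallAutomorphicForms` (the ball
`𝔹² ⊂ ℂ²`, holomorphic functions `BallForms.holomorphic`, the cotangent cocycle
`cotangentCocycle g z = (Jac g z)ᵀ` and the spaces `factorForms Δ cotangentCocycle` of `Δ`-invariant
coefficient vectors of `(1,0)`-forms, Borel §5.13–5.14) and of the holomorphic Poincaré lemma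
`Analysis/Calculus/PoincareLemmaHolomorphicOneForm`.  DEFINITIONS WITH BODIES + THEOREMS; no named fact.

For `F : 𝔹² → ℂ²`, the coefficient vector of the `(1,0)`-form `ω_F = F₀ dz₀ + F₁ dz₁` (this is how the
tree stores holomorphic `1`-forms lifted from a compact ball quotient `Γ \ 𝔹²`:
`UnitaryBallHolomorphicLift.classLift`, Borel, *Automorphic forms on `SL₂(ℝ)`* (1997), §5.14:
«automorphic forms […] can be viewed as `Γ`-invariant holomorphic differential forms on `X`»), we set
`formCLM F w v = Σᵢ Fᵢ(w) vᵢ` (the form as a field of `ℂ`-linear functionals on `ℂ²`), call `F` CLOSED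
(`IsClosedForm`) when the complex derivative of `formCLM F` is symmetric on the ball
(`∂F₀/∂z₁ = ∂F₁/∂z₀`, i.e. `dω_F = 0` for holomorphic `F`), and define the RADIAL PRIMITIVE
`primitive F z = ∫₀¹ Σᵢ Fᵢ(tz) zᵢ dt` (Spivak, *Calculus on Manifolds*, Thm. 4-11, on the star-shaped
ball) and the PERIOD `period F γ = primitive F (γ·0)` of `γ ∈ U(2,1)`.

## What is proved (sorry-free)

* `differentiableOn_formCLM`, `starConvex_zero_ballSet`; **`hasFDerivAt_extend_primitive`** — for `F`
  holomorphic and closed, `P_F = primitive F` is HOLOMORPHIC on the ball with complex differential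
  `dP_F(z) = formCLM F z = Σ Fᵢ(z) dzᵢ` (`primitive_mem_holomorphic`), `P_F(0) = 0` (`primitive_x₀`);
  `primitive_add`, `primitive_smul` (linearity in `F`).
* **`primitive_smul_eq_add_period`** — if `γ^* ω_F = ω_F`, i.e. `(Jac γ z)ᵀ F(γz) = F(z)` for all `z`
  (`factorPullback_cotangentCocycle_apply`), then `P_F(γz) = P_F(z) + c_F(γ)` with the CONSTANT
  `c_F(γ) = period F γ`: the chain rule (`BallModel.hasFDerivAt_actVec`) and the pull-back identity
  (`formCLM_smul_comp_jac`) show that `P_F ∘ γ − P_F` has zero derivative on the (star-shaped) ball.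
* `period_one`, **`period_mul`** (`c_F(γδ) = c_F(γ) + c_F(δ)` when `γ^* ω_F = ω_F`), `period_add`,
  `period_smul`; for `F ∈ factorForms Δ cotangentCocycle`: **`periodHom Δ F`** `: Δ →* Multiplicative ℂ`,
  `primitive_smul_of_mem_factorForms`, and `primitive_smul_eq_self_iff` (`P_F` descends to `Δ \ 𝔹²` iff
  all periods vanish).

For `Δ` the image of the fundamental group `Γ` of a compact ball quotient `X = Γ \ 𝔹²` and
`F = classLift ω` the lift of a holomorphic `1`-form, `c_F : Γ → ℂ` is the period character
`γ ↦ ∫_γ ω` of `ω` and `z ↦ (c_F)_F` is the lift of the Albanese map of `X` to its universal cover — the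
use intended by the cell `pub-hodgecm2` (plan `ALB-H1-ISO`: the Albanese variety of a Picard modular
surface has dimension `h^{1,0}`).

## References

* [Borel1997] A. Borel, *Automorphic forms on `SL₂(ℝ)`*, Cambridge Tracts in Math. 130 (1997),
  §5.13–5.14.
* [Spivak1965] M. Spivak, *Calculus on Manifolds* (1965), Thm. 4-11.
* [HormanderSCV1973] L. Hörmander, *An Introduction to Complex Analysis in Several Variables* (1973),
  §2.1, Thm. 2.2.1.
* [GriffithsHarris1978] P. Griffiths, J. Harris, *Principles of Algebraic Geometry* (1978), Ch. 2 §6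
  (the Albanese map `p ↦ (∫_{p₀}^{p} ω₁, …, ∫_{p₀}^{p} ω_q)` modulo periods).
-/

noncomputable section

open Set Metric MeasureTheory intervalIntegral Filter Matrix MulAction
open scoped Topology Interval
open Literature.Geometry.ComplexHyperbolic
open Literature.Geometry.ComplexHyperbolic.BallModel (U21 Ball Jac x₀ nsq actVec)
open Literature.NumberTheory.Automorphic.AutomorphyFactor
open Literature.Analysis.Calculus

namespace Literature.AlgebraicGeometry.ShimuraVarieties

namespace BallForms

/-! ### The field of `ℂ`-linear forms attached to `F : 𝔹² → ℂ²` -/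

/-- The holomorphic `1`-form `Σᵢ Fᵢ dzᵢ` attached to `F : 𝔹² → ℂ²`, as a field of `ℂ`-linear forms on
`ℂ²` (extended by zero outside the ball): `formCLM F w v = Σᵢ Fᵢ(w) vᵢ`. [cite: Borel1997, §5.14] -/
def formCLM (F : Ball → (Fin 2 → ℂ)) (w : Fin 2 → ℂ) : (Fin 2 → ℂ) →L[ℂ] ℂ :=
  ∑ i : Fin 2, (extend (Fin 2 → ℂ) F w i) • ContinuousLinearMap.proj i

/-- `formCLM F w v = Σᵢ Fᵢ(w) vᵢ` (the `1`-form `Σ Fᵢ dzᵢ` evaluated on `v`). [cite: Borel1997, §5.14] -/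
@[simp] theorem formCLM_apply (F : Ball → (Fin 2 → ℂ)) (w v : Fin 2 → ℂ) :
    formCLM F w v = ∑ i : Fin 2, extend (Fin 2 → ℂ) F w i * v i := by
  simp [formCLM]

/-- `formCLM F w v = F(w) ⬝ᵥ v` (dot product of the coefficient vector with `v`). [cite: Borel1997, §5.14] -/
theorem formCLM_apply_eq_dotProduct (F : Ball → (Fin 2 → ℂ)) (w v : Fin 2 → ℂ) :
    formCLM F w v = extend (Fin 2 → ℂ) F w ⬝ᵥ v := by
  rw [formCLM_apply]; rfl

/-- `formCLM` is additive in `F`. [cite: Borel1997, §5.14] -/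
theorem formCLM_add (F G : Ball → (Fin 2 → ℂ)) (w : Fin 2 → ℂ) :
    formCLM (F + G) w = formCLM F w + formCLM G w := by
  ext v
  simp only [formCLM_apply, extend_add, Pi.add_apply, add_mul, Finset.sum_add_distrib,
    _root_.add_apply]

/-- `formCLM` is homogeneous in `F`. [cite: Borel1997, §5.14] -/
theorem formCLM_smul (c : ℂ) (F : Ball → (Fin 2 → ℂ)) (w : Fin 2 → ℂ) :
    formCLM (c • F) w = c • formCLM F w := by
  ext v
  simp only [formCLM_apply, extend_smul, Pi.smul_apply, smul_eq_mul, mul_assoc, Finset.mul_sum,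
    _root_.smul_apply]

/-- For a holomorphic `F` the field `formCLM F` is complex differentiable on the ball (a holomorphic `1`-form has
holomorphic coefficients). [cite: HormanderSCV1973, §2.1] -/
theorem differentiableOn_formCLM {F : Ball → (Fin 2 → ℂ)} (hF : F ∈ holomorphic (Fin 2 → ℂ)) :
    DifferentiableOn ℂ (formCLM F) ballSet := by
  have h : ∀ i : Fin 2, DifferentiableOn ℂ (fun w ↦ extend (Fin 2 → ℂ) F w i) ballSet :=
    fun i ↦ differentiableOn_pi.1 hF i
  change DifferentiableOn ℂ (fun w ↦ ∑ i : Fin 2, (extend (Fin 2 → ℂ) F w i) • ContinuousLinearMap.proj i)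
    ballSet
  exact DifferentiableOn.fun_sum fun i _ ↦ (h i).smul_const (ContinuousLinearMap.proj (R := ℂ) (φ := fun _ : Fin 2 ↦ ℂ) i)

/-- **Closed holomorphic `(1,0)`-forms on the ball**: the complex derivative of `w ↦ Σᵢ Fᵢ(w) dzᵢ` is
symmetric on the ball (`∂Fᵢ/∂zⱼ = ∂Fⱼ/∂zᵢ`, i.e. `d(Σ Fᵢ dzᵢ) = 0` for a holomorphic `F`).
[cite: HormanderSCV1973, §2.1] -/
def IsClosedForm (F : Ball → (Fin 2 → ℂ)) : Prop :=
  ∀ w ∈ ballSet, ∀ u v : Fin 2 → ℂ, fderiv ℂ (formCLM F) w u v = fderiv ℂ (formCLM F) w v u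

/-- The open unit ball of `ℂ²` is star-shaped at the origin (so Spivak's Poincaré lemma applies to it).
[cite: Spivak1965, Thm. 4-11] -/
theorem starConvex_zero_ballSet : StarConvex ℝ (0 : Fin 2 → ℂ) ballSet := by
  rw [starConvex_zero_iff]
  intro x hx a ha0 ha1
  change nsq (a • x) < 1
  have hx' : nsq x < 1 := hx
  simp only [BallModel.nsq] at hx' ⊢
  have h0 : ‖(a • x) 0‖ = a * ‖x 0‖ := by rw [Pi.smul_apply, norm_smul, Real.norm_of_nonneg ha0]
  have h1 : ‖(a • x) 1‖ = a * ‖x 1‖ := by rw [Pi.smul_apply, norm_smul, Real.norm_of_nonneg ha0]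
  rw [h0, h1]
  have ha2 : a ^ 2 ≤ 1 := by nlinarith
  nlinarith [sq_nonneg ‖x 0‖, sq_nonneg ‖x 1‖, sq_nonneg a]

/-! ### The radial primitive -/

/-- The **radial primitive** `P_F(z) = ∫₀¹ Σᵢ Fᵢ(tz) zᵢ dt` of the `(1,0)`-form `Σ Fᵢ dzᵢ` on the ball,
normalised by `P_F(0) = 0` (Spivak's homotopy operator on the star-shaped ball).
[cite: Spivak1965, Thm. 4-11] -/
def primitive (F : Ball → (Fin 2 → ℂ)) (z : Ball) : ℂ :=
  ∫ t in (0 : ℝ)..1, formCLM F (t • z.1) z.1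

/-- The radial integral of the Poincaré lemma with base point `0`, simplified. [folklore] -/
private theorem radialIntegral_zero_eq (F : Ball → (Fin 2 → ℂ)) :
    (fun y : Fin 2 → ℂ ↦ ∫ t in (0 : ℝ)..1, formCLM F ((0 : Fin 2 → ℂ) + t • (y - 0)) (y - 0)) =
      fun y ↦ ∫ t in (0 : ℝ)..1, formCLM F (t • y) y := by
  funext y; simp only [zero_add, sub_zero]

/-- **`dP_F = Σ Fᵢ dzᵢ` on the ball**: for a closed holomorphic `F`, the radial integral
`y ↦ ∫₀¹ Σᵢ Fᵢ(ty) yᵢ dt` has complex derivative `formCLM F z` at every point `z` of the ball (the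
holomorphic Poincaré lemma `hasFDerivAt_radialIntegral_of_starConvex_of_differentiableOn` on the
star-shaped open ball). [cite: Spivak1965, Thm. 4-11] [cite: HormanderSCV1973, Thm 2.2.1 and §2.1] -/
theorem hasFDerivAt_radialIntegral {F : Ball → (Fin 2 → ℂ)} (hF : F ∈ holomorphic (Fin 2 → ℂ))
    (hc : IsClosedForm F) {w : Fin 2 → ℂ} (hw : w ∈ ballSet) :
    HasFDerivAt (fun y : Fin 2 → ℂ ↦ ∫ t in (0 : ℝ)..1, formCLM F (t • y) y) (formCLM F w) w := by
  have h := hasFDerivAt_radialIntegral_of_starConvex_of_differentiableOn isOpen_ballSet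
    starConvex_zero_ballSet (differentiableOn_formCLM hF) hc hw
  rwa [radialIntegral_zero_eq] at h

/-- On the ball, the zero-extension of the primitive is the radial integral. [cite: Spivak1965, Thm. 4-11] -/
theorem extend_primitive_eq {F : Ball → (Fin 2 → ℂ)} {w : Fin 2 → ℂ} (hw : w ∈ ballSet) :
    extend ℂ (primitive F) w = ∫ t in (0 : ℝ)..1, formCLM F (t • w) w := by
  have h := extend_apply_coe (V := ℂ) (primitive F) ⟨w, hw⟩
  exact h

/-- `primitive F z` is the radial integral at `z` (Spivak's homotopy operator `I` on `1`-forms).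
[cite: Spivak1965, Thm. 4-11] -/
theorem primitive_eq (F : Ball → (Fin 2 → ℂ)) (z : Ball) :
    primitive F z = ∫ t in (0 : ℝ)..1, formCLM F (t • z.1) z.1 := rfl

/-- **The primitive is holomorphic on the ball.** [cite: Spivak1965, Thm. 4-11] [cite: HormanderSCV1973, Thm 2.2.1 and §2.1] -/
theorem primitive_mem_holomorphic {F : Ball → (Fin 2 → ℂ)} (hF : F ∈ holomorphic (Fin 2 → ℂ))
    (hc : IsClosedForm F) : primitive F ∈ holomorphic ℂ := by
  rw [mem_holomorphic_iff]
  have hd : DifferentiableOn ℂ (fun y : Fin 2 → ℂ ↦ ∫ t in (0 : ℝ)..1, formCLM F (t • y) y) ballSet :=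
    fun w hw ↦ (hasFDerivAt_radialIntegral hF hc hw).differentiableAt.differentiableWithinAt
  exact hd.congr fun w hw ↦ extend_primitive_eq hw

/-- **`dP_F(z) = Σ Fᵢ(z) dzᵢ`**: the zero-extended primitive has complex derivative `formCLM F z` at
every point of the ball. [cite: Spivak1965, Thm. 4-11] [cite: HormanderSCV1973, Thm 2.2.1 and §2.1] -/
theorem hasFDerivAt_extend_primitive {F : Ball → (Fin 2 → ℂ)} (hF : F ∈ holomorphic (Fin 2 → ℂ))
    (hc : IsClosedForm F) (z : Ball) :
    HasFDerivAt (extend ℂ (primitive F)) (formCLM F z.1) z.1 := by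
  refine (hasFDerivAt_radialIntegral hF hc (coe_mem_ballSet z)).congr_of_eventuallyEq ?_
  filter_upwards [isOpen_ballSet.mem_nhds (coe_mem_ballSet z)] with w hw
  exact extend_primitive_eq hw

/-- `P_F(0) = 0` (the radial primitive is normalised at the base point). [cite: Spivak1965, Thm. 4-11] -/
@[simp] theorem primitive_x₀ (F : Ball → (Fin 2 → ℂ)) : primitive F x₀ = 0 := by
  simp [primitive_eq]

/-- The primitive is homogeneous in `F` (the homotopy operator `I` is linear). [cite: Spivak1965, Thm. 4-11] -/
theorem primitive_smul (c : ℂ) (F : Ball → (Fin 2 → ℂ)) (z : Ball) :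
    primitive (c • F) z = c * primitive F z := by
  simp only [primitive_eq, formCLM_smul, _root_.smul_apply, smul_eq_mul]
  exact intervalIntegral.integral_const_mul c _

/-- The radial integrand `t ↦ Σᵢ Fᵢ(tw) wᵢ` of a holomorphic `F` is continuous on `[0, 1]` for `w` in the
ball (the segment `[0, w]` stays in the ball). [folklore] -/
private theorem continuousOn_radialIntegrand {F : Ball → (Fin 2 → ℂ)} (hF : F ∈ holomorphic (Fin 2 → ℂ))
    {w : Fin 2 → ℂ} (hw : w ∈ ballSet) :
    ContinuousOn (fun t : ℝ ↦ formCLM F (t • w) w) (uIcc (0 : ℝ) 1) := by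
  have hpath : ∀ t ∈ uIcc (0 : ℝ) 1, t • w ∈ ballSet := by
    intro t ht
    rw [uIcc_of_le zero_le_one] at ht
    have h := starConvex_zero_ballSet hw (sub_nonneg.2 ht.2) ht.1 (sub_add_cancel 1 t)
    simpa using h
  have hcont : ContinuousOn (formCLM F) ballSet := (differentiableOn_formCLM hF).continuousOn
  have h1 : ContinuousOn (fun t : ℝ ↦ formCLM F (t • w)) (uIcc (0 : ℝ) 1) :=
    hcont.comp (by fun_prop) hpath
  exact h1.clm_apply continuousOn_const

/-- The radial integrand of a holomorphic `F` is interval integrable on `[0, 1]`. [folklore] -/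
private theorem intervalIntegrable_radialIntegrand {F : Ball → (Fin 2 → ℂ)} (hF : F ∈ holomorphic (Fin 2 → ℂ))
    (z : Ball) : IntervalIntegrable (fun t : ℝ ↦ formCLM F (t • z.1) z.1) volume 0 1 :=
  (continuousOn_radialIntegrand hF (coe_mem_ballSet z)).intervalIntegrable

/-- The primitive is additive in `F` (holomorphic `F`, `G`; the homotopy operator `I` is linear).
[cite: Spivak1965, Thm. 4-11] -/
theorem primitive_add {F G : Ball → (Fin 2 → ℂ)} (hF : F ∈ holomorphic (Fin 2 → ℂ))
    (hG : G ∈ holomorphic (Fin 2 → ℂ)) (z : Ball) :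
    primitive (F + G) z = primitive F z + primitive G z := by
  simp only [primitive_eq, formCLM_add, _root_.add_apply]
  exact intervalIntegral.integral_add (intervalIntegrable_radialIntegrand hF z)
    (intervalIntegrable_radialIntegrand hG z)

/-! ### Invariance under `γ^*` and the periods -/

/-- **The pull-back identity on the forms.**  If `(Jac γ z)ᵀ F(γz) = F(z)` (the coefficient form of
`γ^*(Σ Fᵢ dzᵢ) = Σ Fᵢ dzᵢ` at `z`, `factorPullback_cotangentCocycle_apply`), then
`formCLM F (γz) ∘ D(γ)(z) = formCLM F z` as `ℂ`-linear forms on `ℂ²`. [cite: Borel1997, §5.14] -/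
theorem formCLM_smul_comp_jac (F : Ball → (Fin 2 → ℂ)) (γ : U21) (z : Ball)
    (hγz : (Jac γ z)ᵀ *ᵥ F (γ • z) = F z) :
    (formCLM F (γ • z).1).comp (LinearMap.toContinuousLinearMap (Matrix.mulVecLin (Jac γ z))) =
      formCLM F z.1 := by
  ext v
  rw [ContinuousLinearMap.comp_apply, formCLM_apply_eq_dotProduct, formCLM_apply_eq_dotProduct,
    extend_apply_coe, extend_apply_coe, ← hγz, Matrix.mulVec_transpose, ← Matrix.dotProduct_mulVec]
  rfl

/-- Chain rule: the derivative of `w ↦ P_F(γ w)` at a point `z` of the ball is `formCLM F (γz) ∘ D(γ)(z)`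
(`BallModel.hasFDerivAt_actVec`). [folklore] -/
private theorem hasFDerivAt_extend_primitive_comp_actVec {F : Ball → (Fin 2 → ℂ)}
    (hF : F ∈ holomorphic (Fin 2 → ℂ)) (hc : IsClosedForm F) (γ : U21) (z : Ball) :
    HasFDerivAt (fun w ↦ extend ℂ (primitive F) (actVec γ w))
      ((formCLM F (γ • z).1).comp (LinearMap.toContinuousLinearMap (Matrix.mulVecLin (Jac γ z)))) z.1 := by
  have h1 := hasFDerivAt_extend_primitive hF hc (γ • z)
  have h2 : HasFDerivAt (extend ℂ (primitive F)) (formCLM F (γ • z).1) (actVec γ z.1) := by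
    rwa [BallModel.actVec_eq]
  exact h2.comp z.1 (BallModel.hasFDerivAt_actVec γ z)

/-- **`P_F ∘ γ − P_F` has zero derivative on the ball** when `γ^* F = F`. [cite: Borel1997, §5.14] -/
theorem hasFDerivAt_extend_primitive_actVec_sub {F : Ball → (Fin 2 → ℂ)}
    (hF : F ∈ holomorphic (Fin 2 → ℂ)) (hc : IsClosedForm F) {γ : U21}
    (hγ : ∀ z : Ball, (Jac γ z)ᵀ *ᵥ F (γ • z) = F z) (z : Ball) :
    HasFDerivAt (fun w ↦ extend ℂ (primitive F) (actVec γ w) - extend ℂ (primitive F) w)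
      (0 : (Fin 2 → ℂ) →L[ℂ] ℂ) z.1 := by
  have h := (hasFDerivAt_extend_primitive_comp_actVec hF hc γ z).sub (hasFDerivAt_extend_primitive hF hc z)
  rwa [formCLM_smul_comp_jac F γ z (hγ z), sub_self] at h

/-- The **period** of the closed holomorphic `(1,0)`-form `Σ Fᵢ dzᵢ` along `γ ∈ U(2,1)`:
`c_F(γ) = P_F(γ·0) − P_F(0) = P_F(γ·0)`. [cite: Borel1997, §5.14] -/
def period (F : Ball → (Fin 2 → ℂ)) (γ : U21) : ℂ :=
  primitive F (γ • x₀)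

/-- **Transformation law of the primitive**: if `γ^* F = F` then `P_F(γz) = P_F(z) + c_F(γ)` for every
`z` in the ball — `P_F ∘ γ − P_F` has zero derivative (`hasFDerivAt_extend_primitive_actVec_sub`) on the
star-shaped (hence connected) ball, so it is the constant `P_F(γ·0) − P_F(0)` (mean value inequality
on the segment `[0, z]`). [cite: Borel1997, §5.14] [cite: Spivak1965, Thm. 4-11] -/
theorem primitive_smul_eq_add_period {F : Ball → (Fin 2 → ℂ)} (hF : F ∈ holomorphic (Fin 2 → ℂ))
    (hc : IsClosedForm F) {γ : U21} (hγ : ∀ z : Ball, (Jac γ z)ᵀ *ᵥ F (γ • z) = F z) (z : Ball) :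
    primitive F (γ • z) = primitive F z + period F γ := by
  set G : (Fin 2 → ℂ) → ℂ := fun w ↦ extend ℂ (primitive F) (actVec γ w) - extend ℂ (primitive F) w
    with hGdef
  -- zero derivative along the segment `[0, z] ⊆ ballSet`
  have hseg : segment ℝ (0 : Fin 2 → ℂ) z.1 ⊆ ballSet :=
    starConvex_zero_ballSet.segment_subset (coe_mem_ballSet z)
  have hG : ∀ x ∈ segment ℝ (0 : Fin 2 → ℂ) z.1,
      HasFDerivWithinAt G ((fun _ ↦ (0 : (Fin 2 → ℂ) →L[ℂ] ℂ)) x) (segment ℝ (0 : Fin 2 → ℂ) z.1) x := by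
    intro x hx
    exact (hasFDerivAt_extend_primitive_actVec_sub hF hc hγ ⟨x, hseg hx⟩).hasFDerivWithinAt
  have hbound : ∀ x ∈ segment ℝ (0 : Fin 2 → ℂ) z.1, ‖(fun _ ↦ (0 : (Fin 2 → ℂ) →L[ℂ] ℂ)) x‖ ≤ 0 :=
    fun x _ ↦ by simp
  have h0 := (convex_segment (0 : Fin 2 → ℂ) z.1).norm_image_sub_le_of_norm_hasFDerivWithin_le hG hbound
    (left_mem_segment ℝ _ _) (right_mem_segment ℝ _ _)
  rw [zero_mul, norm_le_zero_iff, sub_eq_zero] at h0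
  -- `h0 : G z = G 0`; read both sides on the ball
  have hz : G z.1 = primitive F (γ • z) - primitive F z := by
    simp only [hGdef, BallModel.actVec_eq, extend_apply_coe]
  have hx : G 0 = period F γ := by
    have h00 : (0 : Fin 2 → ℂ) = x₀.1 := (BallModel.x₀_val).symm
    simp only [hGdef]
    rw [h00, BallModel.actVec_eq, extend_apply_coe, extend_apply_coe, primitive_x₀, sub_zero]
    rfl
  rw [hz, hx] at h0
  rw [← h0, add_comm, sub_add_cancel]

/-- `c_F(1) = 0`. [cite: GriffithsHarris1978, Ch. 2 §6] -/
@[simp] theorem period_one (F : Ball → (Fin 2 → ℂ)) : period F 1 = 0 := by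
  simp [period]

/-- **The periods are additive**: `c_F(γδ) = c_F(γ) + c_F(δ)` when `γ^* F = F` (and `δ` is arbitrary):
`P_F(γδ·0) = P_F(δ·0) + c_F(γ)`. [cite: Borel1997, §5.14] -/
theorem period_mul {F : Ball → (Fin 2 → ℂ)} (hF : F ∈ holomorphic (Fin 2 → ℂ)) (hc : IsClosedForm F)
    {γ : U21} (hγ : ∀ z : Ball, (Jac γ z)ᵀ *ᵥ F (γ • z) = F z) (δ : U21) :
    period F (γ * δ) = period F γ + period F δ := by
  rw [period, mul_smul, primitive_smul_eq_add_period hF hc hγ, period, period, add_comm]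

/-- The period is homogeneous in `F`. [cite: GriffithsHarris1978, Ch. 2 §6] -/
theorem period_smul (c : ℂ) (F : Ball → (Fin 2 → ℂ)) (γ : U21) :
    period (c • F) γ = c * period F γ :=
  primitive_smul c F _

/-- The period is additive in `F` (holomorphic `F`, `G`). [cite: GriffithsHarris1978, Ch. 2 §6] -/
theorem period_add {F G : Ball → (Fin 2 → ℂ)} (hF : F ∈ holomorphic (Fin 2 → ℂ))
    (hG : G ∈ holomorphic (Fin 2 → ℂ)) (γ : U21) :
    period (F + G) γ = period F γ + period G γ :=
  primitive_add hF hG _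

/-- Membership in `factorForms Δ cotangentCocycle` is the pull-back identity `(Jac γ z)ᵀ F(γz) = F(z)`
for all `γ ∈ Δ`. [cite: Borel1997, §5.14] -/
theorem transpose_jac_mulVec_eq_of_mem_factorForms {Δ : Subgroup U21} {F : Ball → (Fin 2 → ℂ)}
    (hΔ : F ∈ factorForms Δ cotangentCocycle) {γ : U21} (hγ : γ ∈ Δ) (z : Ball) :
    (Jac γ z)ᵀ *ᵥ F (γ • z) = F z := by
  rw [← cotangentCocycle_apply]
  exact (hΔ γ hγ z).symm

/-- **The period homomorphism** of a closed holomorphic `(1,0)`-form `Σ Fᵢ dzᵢ` for `Δ ≤ U(2,1)`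
(`F ∈ factorForms Δ cotangentCocycle`): `γ ↦ c_F(γ)`, a homomorphism `Δ → (ℂ, +)` (written
multiplicatively). For `Δ` the image of the fundamental group of a compact ball quotient these are the
periods of the holomorphic `1`-form over loops. [cite: Borel1997, §5.14] -/
def periodHom (Δ : Subgroup U21) (F : Ball → (Fin 2 → ℂ)) (hF : F ∈ holomorphic (Fin 2 → ℂ))
    (hc : IsClosedForm F) (hΔ : F ∈ factorForms Δ cotangentCocycle) : Δ →* Multiplicative ℂ where
  toFun γ := Multiplicative.ofAdd (period F γ)
  map_one' := by simp
  map_mul' γ δ := by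
    rw [← ofAdd_add, Subgroup.coe_mul,
      period_mul hF hc (transpose_jac_mulVec_eq_of_mem_factorForms hΔ γ.2) (δ : U21)]

/-- Unfolding `periodHom`: the period homomorphism evaluates to the periods. [cite: Borel1997, §5.14] -/
@[simp] theorem periodHom_apply {Δ : Subgroup U21} {F : Ball → (Fin 2 → ℂ)}
    (hF : F ∈ holomorphic (Fin 2 → ℂ)) (hc : IsClosedForm F) (hΔ : F ∈ factorForms Δ cotangentCocycle)
    (γ : Δ) : periodHom Δ F hF hc hΔ γ = Multiplicative.ofAdd (period F γ) := rfl

/-- **Transformation law for a subgroup**: for `F ∈ factorForms Δ cotangentCocycle` closed holomorphic,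
`P_F(γz) = P_F(z) + c_F(γ)` for all `γ ∈ Δ`, `z ∈ 𝔹²`. [cite: Borel1997, §5.14] -/
theorem primitive_smul_of_mem_factorForms {Δ : Subgroup U21} {F : Ball → (Fin 2 → ℂ)}
    (hF : F ∈ holomorphic (Fin 2 → ℂ)) (hc : IsClosedForm F) (hΔ : F ∈ factorForms Δ cotangentCocycle)
    {γ : U21} (hγ : γ ∈ Δ) (z : Ball) :
    primitive F (γ • z) = primitive F z + period F γ :=
  primitive_smul_eq_add_period hF hc (transpose_jac_mulVec_eq_of_mem_factorForms hΔ hγ) z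

/-- **Vanishing periods force invariance**: if `γ^* F = F` and `c_F(γ) = 0` then `P_F` is `γ`-invariant;
conversely `P_F` is `Δ`-invariant iff all periods vanish. [cite: Borel1997, §5.14] -/
theorem primitive_smul_eq_self_iff {Δ : Subgroup U21} {F : Ball → (Fin 2 → ℂ)}
    (hF : F ∈ holomorphic (Fin 2 → ℂ)) (hc : IsClosedForm F) (hΔ : F ∈ factorForms Δ cotangentCocycle) :
    (∀ γ ∈ Δ, ∀ z : Ball, primitive F (γ • z) = primitive F z) ↔ ∀ γ ∈ Δ, period F γ = 0 := by
  constructor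
  · intro h γ hγ
    have h1 := h γ hγ x₀
    rwa [primitive_x₀] at h1
  · intro h γ hγ z
    rw [primitive_smul_of_mem_factorForms hF hc hΔ hγ, h γ hγ, add_zero]

end BallForms

end Literature.AlgebraicGeometry.ShimuraVarieties

end
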